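import Summits.HubbardSuperconductivity.HubbardSuperconductivity.Theses.LiebTwin

/-!
# Route `LiebTwin`, crux `DWavePolarisedDiscordance` (item `stmt-HubbardSuperconductivity-15314`),
# line `registered`: the load-bearing stub is implied by the crux

Helper (`--supports stmt-HubbardSuperconductivity-15314`) for the line `registered`
(`Cruxes/DWavePolarisedDiscordance/Lines/registered.lean`). The line cuts the crux
`κ·(F_s(φ̃) − F_s(φ)) − εL⁴ ≤ F_d(φ) − F_d(φ̃)` into three stubs; its load-bearing stub
`stub_massFeedsBondSinglets` reads `κ·(F_s(φ̃) − F_s(φ)) − εL⁴ ≤ F_d(φ) + F_xs(φ)`.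

**This file proves `DWavePolarisedDiscordance → stub_massFeedsBondSinglets`** (with the SAME `κ` and
`L₀`): since `F_d(φ̃) = ‖Δ_d φ̃‖² ≥ 0` and `F_xs(φ) = ‖Δ_xs φ‖² ≥ 0`,
`F_d(φ) − F_d(φ̃) ≤ F_d(φ) ≤ F_d(φ) + F_xs(φ)`. Hence the stub is at least as hard as the crux it
is meant to cut (a kernel-checked certificate that the decomposition does not reduce the crux: the
other two stubs, `stub_extendedSSubordinate` and `stub_rectificationDepletesDWave`, are strict
strengthenings carrying the selection / lobe-cancellation physics).

Contents: `re_expect_pairField_conjTranspose_mul_nonneg` (`0 ≤ Re⟨χ, Δ_gᴴ Δ_g χ⟩` for every form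
factor `g`, side `L` and vector `χ`), and the implication
`stub_massFeedsBondSinglets_of_dWavePolarisedDiscordance`. No definition, no named fact.
-/

-- `dupNamespace`: the summit and the problem are both named `HubbardSuperconductivity` (layout D-0022)
set_option linter.dupNamespace false

namespace Summit.HubbardSuperconductivity.HubbardSuperconductivity.Theorems

open Literature.MathematicalPhysics.QuantumLattice
open scoped Matrix MatrixOrder Matrix.Norms.L2Operator ComplexOrder

/-- `Re⟨χ, Δ_gᴴ Δ_g χ⟩ = ‖Δ_g χ‖² ≥ 0` for every form factor `g`, every side `L` and every Fock
vector `χ` (no normalisation needed). [folklore] -/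
theorem re_expect_pairField_conjTranspose_mul_nonneg (g : Literature.Probability.LatticeModels.Site 2 → ℝ)
    (L : ℕ) [NeZero L] (χ : Fock (Orb (FermionTorus 2 L))) :
    0 ≤ (expect ((pairField g L)ᴴ * pairField g L) χ).re := by
  rw [PosSemidefTrace.expect_conjTranspose_mul, ← norm_toLp_sq_eq_re]
  positivity

/-- **The load-bearing stub of line `registered` is implied by the crux.** If
`DWavePolarisedDiscordance` holds (for every `(U, δ)` in the box there is `κ > 0` such that for every
`ε > 0`, eventually in even `L`, every normalised sector ground state `φ` has
`κ·(F_s(φ̃) − F_s(φ)) − εL⁴ ≤ F_d(φ) − F_d(φ̃)`), then the registered stub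
`stub_massFeedsBondSinglets` holds with the same `κ` and `L₀`:
`κ·(F_s(φ̃) − F_s(φ)) − εL⁴ ≤ F_d(φ) + F_xs(φ)`, because `F_d(φ̃) ≥ 0` and `F_xs(φ) ≥ 0`
(`re_expect_pairField_conjTranspose_mul_nonneg`). [folklore] -/
theorem stub_massFeedsBondSinglets_of_dWavePolarisedDiscordance :
    Summit.HubbardSuperconductivity.HubbardSuperconductivity.Theses.LiebTwin.DWavePolarisedDiscordance →
    ∀ U ∈ Set.Ioc (0 : ℝ) 4, ∀ δ ∈ Set.Icc (1 / 10 : ℝ) (3 / 10), ∃ κ : ℝ, 0 < κ ∧ ∀ ε : ℝ, 0 < ε →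
      ∃ L₀ : ℕ, ∀ (L : ℕ) [NeZero L], L₀ ≤ L → Even L → ∀ φ : Fock (Orb (FermionTorus 2 L)),
        star φ ⬝ᵥ φ = 1 →
          IsGroundStateInSector (hubbardTorus 2 L 1 U) (2 * ⌊(1 - δ) * (L : ℝ) ^ 2 / 2⌋₊) 0 φ →
            κ * ((expect ((pairField sWave L)ᴴ * pairField sWave L)
                    (liebVec ⌊(1 - δ) * (L : ℝ) ^ 2 / 2⌋₊
                      (CFC.abs (liebW ⌊(1 - δ) * (L : ℝ) ^ 2 / 2⌋₊ φ)))).re -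
                  (expect ((pairField sWave L)ᴴ * pairField sWave L) φ).re) -
                ε * (L : ℝ) ^ 4 ≤
              (expect ((pairField dWaveFormFactor L)ᴴ * pairField dWaveFormFactor L) φ).re +
                (expect ((pairField extendedSWave L)ᴴ * pairField extendedSWave L) φ).re := by
  intro h U hU δ hδ
  obtain ⟨κ, hκ, h⟩ := h U hU δ hδ
  refine ⟨κ, hκ, fun ε hε => ?_⟩
  obtain ⟨L₀, h⟩ := h ε hε
  refine ⟨L₀, fun L _ hL hE φ hφ hgs => ?_⟩
  have key := h L hL hE φ hφ hgs
  have hD' := re_expect_pairField_conjTranspose_mul_nonneg dWaveFormFactor L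
    (liebVec ⌊(1 - δ) * (L : ℝ) ^ 2 / 2⌋₊ (CFC.abs (liebW ⌊(1 - δ) * (L : ℝ) ^ 2 / 2⌋₊ φ)))
  have hX := re_expect_pairField_conjTranspose_mul_nonneg extendedSWave L φ
  linarith

end Summit.HubbardSuperconductivity.HubbardSuperconductivity.Theorems
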